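import Mathlib

/-!
# StrengthenEinfRow — the `E₂^{0,2}` FLOOR behind the H²-FORM door row (plan-lens-HodgeAV-strengthen g6, MEMO-09 v1.3 §3.3 (η))

Evidence-only crux workfile on `stmt-HodgeConjecture-18881` (D-0145 token: line stmt-HodgeConjecture-18881
Cruxes/BlochSeedDiscOne/Lines/birth.lean 814a6a70c14e831a stub_rung_pad4_seedAt).  Machine ≠ kernel; an inequality
of dimensions ≠ a sheaf ≠ semiregular ≠ a SEED.  NOTHING here is proved toward HC ∕ HC_CM ∕ HC_AV ∕ №4 ∕ 26512 ∕ 18881 ∕ H2.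

WHAT IS TYPED.  The linear-algebra heart of the lemma

  `dim Ext²(𝓔,𝓔) ≥ dim E_∞^{0,2} = dim E₂^{0,2} ≥ h²(ℰnd 𝓟) + h²(ℰnd 𝓝) − h²(𝓟^∨⊗𝓝) − h²(𝓝^∨⊗𝓟)`

for a two-term locally free presentation `0 → 𝓟 →φ 𝓝 → 𝓔 → 0` (first hypercohomology spectral sequence of
`ℋom•([𝓟→𝓝],[𝓟→𝓝]) = [𝓝^∨𝓟 → ℰnd 𝓟 ⊕ ℰnd 𝓝 → 𝓟^∨𝓝]`, columns a ∈ {−1,0,1}, so no `d_r`, r ≥ 2, touches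
bidegree (0,2)):  for ANY three-term complex of finite-dimensional vector spaces `U →f V →g W` (g ∘ f = 0) the middle
homology has dimension ≥ dim V − dim U − dim W (`middle_homology_floor`), and a filtered space is at least as big as one
graded piece (used only in words).  The sheaf-theoretic identification of the E₁ terms is PEN (memo §3.3 (η)), the four
h² digits per address are MACHINE (engine `einf_rows.py`, sheaf8-1's twisted factor rule verbatim; the four digits of the two
live addresses are ×2 by idea-crit-hsem-2's own code, bus l.8131 ∕ l.8210), and the door arithmetic is `decide`d below.

v1.1 (MEMO-09 v1.4 §3.3 (θ), director R19.363 (4)(b) «LEMMA Σ-FLOOR: state it exactly»).  The linear-algebra heart of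
hsemireg-c4-1 g5's (F4) (weighted König on the block-supported `d₁`), which refines the whole-column floor above to c4-1's
ROW Σ-K ∕ Σ-H: `block_kernel_floor` (d maps the block subspace `VI` into `WN` ⇒ dim(ker d ⊓ VI) ≥ dim VI − dim WN),
`quotient_floor` (dim A ≤ dim(Z ⧸ M) + dim(A ⊓ M)), and their combination `source_set_floor`
(dim VI − dim WN − dim(M ⊓ VI) ≤ dim(ker d ⧸ M), M = the incoming image).  The SOURCE-SET form of LEMMA Σ-FLOOR (memo (θ):
I(B) = End-𝓝 blocks with domain in A(B) ∪ End-𝓟 blocks with domain in B, neighbourhood ⊆ out-blocks with domain in B) is this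
theorem with `VI = V_{I(B)}`, `WN = W_{B×𝓝}`; the identification of blocks and supports ((F2)∕(F3)) stays PEN (c4-1 §3, ×2 on the
pen by idea-crit-hsem-2 l.8276), the digits are MACHINE (`eng/sigma_floor.py`, own Dinic max-flow, sheaf8-1 factor rule verbatim;
every common digit equal to c4-1's `ext2ub.py --sigma` and `--hall` tables), the arithmetic instances are `norm_num`.
-/

set_option linter.dupNamespace false
set_option autoImplicit false

namespace Summit.HodgeConjecture.HodgeConjecture.Cruxes.BlochSeedDiscOne.EinfRow

open Module

section floor
variable {K : Type*} [Field K] {U V W : Type*}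
  [AddCommGroup U] [Module K U] [FiniteDimensional K U]
  [AddCommGroup V] [Module K V] [FiniteDimensional K V]
  [AddCommGroup W] [Module K W] [FiniteDimensional K W]

/-- The image of `f` inside `ker g`, for a complex `U →f V →g W`. -/
def imInKer (f : U →ₗ[K] V) (g : V →ₗ[K] W) (hfg : ∀ u, g (f u) = 0) : Submodule K (LinearMap.ker g) :=
  LinearMap.range (LinearMap.codRestrict (LinearMap.ker g) f (fun u => by simpa [LinearMap.mem_ker] using hfg u))

/-- MIDDLE HOMOLOGY FLOOR: for a three-term complex of finite-dimensional vector spaces `U →f V →g W` (`g ∘ f = 0`),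
`dim V ≤ dim H + dim U + dim W` where `H = ker g ⧸ im f` — i.e. `dim H ≥ dim V − dim U − dim W`.
Applied to the (a = −1, 0, 1; q = 2) row of the E₁ page it gives `dim E₂^{0,2} ≥ h²(End P) + h²(End N) − h²(N^∨P) − h²(P^∨N)`. -/
theorem middle_homology_floor (f : U →ₗ[K] V) (g : V →ₗ[K] W) (hfg : ∀ u, g (f u) = 0) :
    finrank K V ≤ finrank K (LinearMap.ker g ⧸ imInKer f g hfg) + finrank K U + finrank K W := by
  have h1 : finrank K (LinearMap.range g) + finrank K (LinearMap.ker g) = finrank K V :=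
    LinearMap.finrank_range_add_finrank_ker g
  have h2 : finrank K (LinearMap.range g) ≤ finrank K W := Submodule.finrank_le _
  have h3 : finrank K (LinearMap.ker g ⧸ imInKer f g hfg) + finrank K (imInKer f g hfg) = finrank K (LinearMap.ker g) :=
    Submodule.finrank_quotient_add_finrank _
  have h4 : finrank K (imInKer f g hfg) ≤ finrank K U := by
    unfold imInKer; exact LinearMap.finrank_range_le _
  omega

/-- A graded piece is no bigger than the whole: if `E` carries a subspace `F¹ ≤ F⁰ ≤ E` then `dim (F⁰ ⧸ F¹) ≤ dim E`
(the words-level step `dim Ext² ≥ dim E_∞^{0,2}`). -/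
theorem graded_piece_le (E : Type*) [AddCommGroup E] [Module K E] [FiniteDimensional K E]
    (F0 : Submodule K E) (F1 : Submodule K F0) : finrank K (F0 ⧸ F1) ≤ finrank K E := by
  have h1 : finrank K (F0 ⧸ F1) + finrank K F1 = finrank K F0 := Submodule.finrank_quotient_add_finrank F1
  have h2 : finrank K F0 ≤ finrank K E := Submodule.finrank_le F0
  omega

/-- DOOR COROLLARY (arithmetic shell): a floor above the target dimension forbids injectivity.  If `ℓ ≤ e` (floor ≤ dim Ext²),
`t < ℓ` (target dimension below the floor) then no linear map from an `e`-dimensional space to a `t`-dimensional one is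
injective — recorded as the dimension inequality it reduces to. -/
theorem no_injection_of_floor {e t ℓ : ℕ} (hle : ℓ ≤ e) (ht : t < ℓ) : ¬ e ≤ t := by omega

/-- Injective linear maps do not lower dimension (the fact `no_injection_of_floor` is applied to: σ_{≤3} injective ⇒ ext² ≤ 5 572). -/
theorem finrank_le_of_injective (E T : Type*) [AddCommGroup E] [Module K E] [FiniteDimensional K E]
    [AddCommGroup T] [Module K T] [FiniteDimensional K T] (σ : E →ₗ[K] T) (hσ : Function.Injective σ) :
    finrank K E ≤ finrank K T :=
  LinearMap.finrank_le_finrank_of_injective hσ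

/-- BLOCK KERNEL FLOOR (the linear-algebra heart of hsemireg-c4-1 g5 (F4), first clause; weighted König is the combinatorial
wrapper around it): if a linear map `d : V → W` sends a subspace `VI` into a subspace `WN` (block support: `VI = ⊕_{v ∈ I} V_v`,
`WN = ⊕_{w ∈ N(I)} W_w`), then `dim (ker d ⊓ VI) ≥ dim VI − dim WN`; stated additively. -/
theorem block_kernel_floor (d : V →ₗ[K] W) (VI : Submodule K V) (WN : Submodule K W)
    (h : ∀ v ∈ VI, d v ∈ WN) :
    finrank K VI ≤ finrank K ↥(LinearMap.ker d ⊓ VI) + finrank K WN := by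
  -- the restricted block map VI → WN
  let d' : VI →ₗ[K] WN := LinearMap.codRestrict WN (d ∘ₗ VI.subtype) (fun v => h v v.2)
  have rn : finrank K (LinearMap.range d') + finrank K (LinearMap.ker d') = finrank K VI :=
    LinearMap.finrank_range_add_finrank_ker d'
  have h1 : finrank K (LinearMap.range d') ≤ finrank K WN := Submodule.finrank_le _
  -- ker d' embeds into ker d ⊓ VI
  let j : LinearMap.ker d' →ₗ[K] ↥(LinearMap.ker d ⊓ VI) :=
    LinearMap.codRestrict (LinearMap.ker d ⊓ VI) (VI.subtype ∘ₗ (LinearMap.ker d').subtype) (by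
      intro u
      have hu : d' u.1 = 0 := u.2
      have hW : ((d' u.1 : WN) : W) = ((0 : WN) : W) := congrArg Subtype.val hu
      have hd : d (u.1 : V) = 0 := hW
      exact ⟨LinearMap.mem_ker.mpr hd, u.1.2⟩)
  have hj : Function.Injective j := by
    intro a b hab
    have h' := congrArg (fun z : ↥(LinearMap.ker d ⊓ VI) => (z : V)) hab
    apply Subtype.ext; apply Subtype.ext
    simpa [j] using h'
  have h2 : finrank K (LinearMap.ker d') ≤ finrank K ↥(LinearMap.ker d ⊓ VI) :=
    LinearMap.finrank_le_finrank_of_injective hj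
  omega

/-- QUOTIENT FLOOR (second clause of (F4)): for subspaces `A, M` of a space `Z` (here `Z = ker d`, `A = ker d ⊓ VI`, `M = im d₀`),
`dim A ≤ dim (Z ⧸ M) + dim (A ⊓ M)` — the homology `Z ⧸ M` is at least `dim A − dim (A ⊓ M)`, and `dim (A ⊓ M) ≤ dim (M ⊓ VI)`
is what the in-image vertex cover bounds. -/
theorem quotient_floor (Z : Type*) [AddCommGroup Z] [Module K Z] [FiniteDimensional K Z] (A M : Submodule K Z) :
    finrank K A ≤ finrank K (Z ⧸ M) + finrank K ↥(A ⊓ M) := by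
  have h1 := Submodule.finrank_sup_add_finrank_inf_eq A M
  have h2 := Submodule.finrank_quotient_add_finrank M
  have h3 : finrank K ↥(A ⊔ M) ≤ finrank K Z := Submodule.finrank_le _
  omega

/-- SOURCE-SET FLOOR, additive form of the chain `dim VI − dim WN − dim (M ⊓ VI) ≤ dim (ker d ⧸ M)`: the three kernel facts above
combined (with `A = ker d ⊓ VI`, and `A ⊓ M ≤ M ⊓ VI`). -/
theorem source_set_floor (d : V →ₗ[K] W) (VI : Submodule K V) (WN : Submodule K W) (M : Submodule K V)
    (h : ∀ v ∈ VI, d v ∈ WN) :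
    finrank K VI ≤ finrank K (↥(LinearMap.ker d) ⧸ Submodule.comap (LinearMap.ker d).subtype M)
      + finrank K WN + finrank K ↥(M ⊓ VI) := by
  have hk := block_kernel_floor d VI WN h
  -- work inside Z = ker d
  set Z := LinearMap.ker d with hZ
  set M' : Submodule K Z := Submodule.comap Z.subtype M with hM'
  let A' : Submodule K Z := Submodule.comap Z.subtype (Z ⊓ VI)
  have hq := quotient_floor (K := K) Z A' M'
  -- dim A' = dim (ker d ⊓ VI)  (Z.subtype is injective and ker d ⊓ VI ≤ Z)
  have hA : finrank K A' = finrank K ↥(Z ⊓ VI) := by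
    have e := Submodule.comapSubtypeEquivOfLe (p := Z ⊓ VI) (q := Z) inf_le_left
    exact LinearEquiv.finrank_eq e
  -- dim (A' ⊓ M') ≤ dim (M ⊓ VI): A' ⊓ M' maps injectively into M ⊓ VI under Z.subtype
  have hAM : finrank K ↥(A' ⊓ M') ≤ finrank K ↥(M ⊓ VI) := by
    let i : ↥(A' ⊓ M') →ₗ[K] ↥(M ⊓ VI) :=
      LinearMap.codRestrict (M ⊓ VI) (Z.subtype ∘ₗ (A' ⊓ M').subtype) (by
        intro u
        obtain ⟨hA1, hM1⟩ := u.2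
        have hA2 : ((u.1 : Z) : V) ∈ Z ⊓ VI := hA1
        have hM2 : ((u.1 : Z) : V) ∈ M := hM1
        exact ⟨hM2, hA2.2⟩)
    have hi : Function.Injective i := by
      intro a b hab
      have h' := congrArg (fun z : ↥(M ⊓ VI) => (z : V)) hab
      apply Subtype.ext; apply Subtype.ext
      simpa [i] using h'
    exact LinearMap.finrank_le_finrank_of_injective hi
  omega

end floor

section digits
/-! ## The door digit and the H²-form values of record (machine digits re-checked as closed arithmetic)
`door = h^{0,2} + h^{1,3} + h^{2,4} + h^{3,5}` of an abelian 8-fold `= C(8,0)C(8,2) + C(8,1)C(8,3) + C(8,2)C(8,4) + C(8,3)C(8,5)`. -/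

theorem door_eq : Nat.choose 8 0 * Nat.choose 8 2 + Nat.choose 8 1 * Nat.choose 8 3 + Nat.choose 8 2 * Nat.choose 8 4
    + Nat.choose 8 3 * Nat.choose 8 5 = 5572 := by decide

/-- τ ROOM (a009d00f97400f4e ≡ 4545dca3500d9a20 ≡ d3cd3db75c00a9ea; rank 40): ℓ₀₂ = h²(End 𝓟) + h²(End 𝓝) − h²(𝓟^∨𝓝) − h²(𝓝^∨𝓟)
= 28 416 + 122 816 − 128 320 − 15 168 = 7 744 > 5 572 ⇒ DOOR-DEAD for every injective φ (memo §3.3 (η)). -/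
theorem tauRoom_floor : (28416 + 122816 : ℤ) - 128320 - 15168 = 7744 ∧ (5572 : ℤ) < 7744 := by norm_num

/-- TW32b-p8-plain (ee644743a4db545e; rank 40): ℓ₀₂ = 28 416 + 147 904 − 153 920 − 15 168 = 7 232 > 5 572 ⇒ DOOR-DEAD. -/
theorem p8plain_floor : (28416 + 147904 : ℤ) - 153920 - 15168 = 7232 ∧ (5572 : ℤ) < 7232 := by norm_num

/-- a1a8405da9ba0240 (TW32b-p32-sharp; rank 64): ℓ₀₂ = 28 416 + 46 912 − 62 784 − 15 168 = −2 624 ≤ 5 572 ⇒ the row is SILENT (vacuous);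
what the E∞σ engine must then find for a PASS on this column alone: rank d₁^{(0,2)→(1,2)} + rank d₁^{(−1,2)→(0,2)} ≥ 75 328 − 5 572 = 69 756
(of at most 62 784 + 15 168 = 77 952). -/
theorem a1a8405d_floor : (28416 + 46912 : ℤ) - 62784 - 15168 = -2624 ∧ (75328 : ℤ) - 5572 = 69756 ∧ (62784 + 15168 : ℤ) = 77952 := by
  norm_num

/-- SOURCE-SET FLOOR on a1a8405da9ba0240 (TW32b-p32-sharp, rank 64), mixed Künneth degree k = (0,0,1,1): with B = the sixteen
bottom letters (levels 12,12,12,12) and A(B) = the forty-eight 13-level cells, w(I(B)) = 7 488 + 3 232 = 10 720, w(N(I(B))) = 5 008,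
in-image vertex cover 2 496 ⇒ dim E₂^{0,2}[k] ≥ 3 216 per mixed k; pure k: 72; total 6·3 216 + 4·72 = 19 584 > 5 572 (c4-1's ROW Σ-H digit,
reproduced by `eng/sigma_floor.py`). -/
theorem a1a8405d_sourceSet : (7488 + 3232 : ℤ) = 10720 ∧ (10720 : ℤ) - 5008 - 2496 = 3216 ∧ (6 * 3216 + 4 * 72 : ℤ) = 19584 ∧ (5572 : ℤ) < 19584 := by
  norm_num

/-- τ ROOM a009d00f ≡ 4545dca3 ≡ d3cd3db7, mixed k: deficiency 8 784 − in-cover 2 496 = 6 288; pure k: 308 − 36 = 272; Σ-H = 6·6 288 + 4·272 = 38 816. -/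
theorem tauRoom_sourceSet : (8784 : ℤ) - 2496 = 6288 ∧ (308 : ℤ) - 36 = 272 ∧ (6 * 6288 + 4 * 272 : ℤ) = 38816 ∧ (5572 : ℤ) < 38816 := by
  norm_num

/-- RB16-twist-uncovered 2226380d440e4d8f: Σ-H = Σ-K = 6·768 + 4·176 = 5 312 ≤ 5 572 — NOT decided by the (0,2)-column count (it is dead by PP₀ only):
the cheapest witness that the count road alone does not close every two-term LINE-14 design of record. -/
theorem rb16uncovered_alive_at_count : (6 * 768 + 4 * 176 : ℤ) = 5312 ∧ (5312 : ℤ) ≤ 5572 := by norm_num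

/-- SCALING: block weights are quadratic monomials `m_a m_b e`, so every floor of this file scales by `λ²` under `m ↦ λ m`;
the instance used in the BUDGET COROLLARY: a design with floor `s > 0` at scale 1 is door-dead at every scale `λ` with `λ² s > 5572`,
e.g. `s = 5312`, `λ = 2`. -/
theorem scaling_instance : (2 : ℤ) ^ 2 * 5312 = 21248 ∧ (5572 : ℤ) < 21248 := by norm_num

end digits

end Summit.HodgeConjecture.HodgeConjecture.Cruxes.BlochSeedDiscOne.EinfRow
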